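import Summits.QuantumFields.YangMills.Theorems.UnitScaleTiltProp7TrueLinIterStructure
import HarnessLib

/-!
# Route `UnitScaleTilt`, crux K1 «MinimiserStabilityRegPr» (stmt-QuantumFields-19200), route-R [RP] curved, the `Q`-junction (R2), file A1 —
# THE SOURCED STRUCTURE RECURSION: a family `D_j` driven by the true linearised (0.4)-descent WITH SOURCES, `D_{j+1} = T_j D_j + R_j`,
# splits EXACTLY as `D_j = G^D_j + P_{Ū₀^{(j)}}Λ^D_j` with `G^D_{j+1} = T_jG^D_j − P(CM_jG^D_j) + R_j`, `Λ^D_{j+1} = CM_jG^D_j + Λ^D_j ∘ emb`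

Cell `ym3-torus`, keyed width hand `ym-routeR-w3` (D-0154 (3c); successor session; (R2) LOCATED 2026-08-28 08:42Z on the cell bus).  THEOREMS ONLY (0 `def`,
0 `sorry`); `--supports stmt-QuantumFields-19200`, count-neutral.  YM₃ on T³ is a ladder rung (R3), not the Clay problem; nothing here claims the stub, the
crux, d = 4 or the mass gap.

WHY.  ✓ p606268 `Prop7TrueLinIterStructure.trueLinIter_structure` splits the EXACT linear iterate `T^{(k)}Y` along the background tower.  For the nonlinear
(0.4)-fibre `W̄^{(k)} = Ū₀^{(k)}` the level ratios `Y_j = W̄^{(j)}Ū₀^{(j)*} − 1` obey the linear recursion only up to the one-step true-linearisation remainders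
`R_j = Y_{j+1} − T_jY_j` (★p1's ✓ `Prop7HolRatioPerStep.norm_avgFun_ratio_sub_one_sub_trueLin_le`: `‖R_j(c)‖ ≤ 260·m_j(c)²`), so `D_j := Y_j − T^{(j)}Y_0`
obeys `D_0 = 0`, `D_{j+1} = T_jD_j + R_j`, and on the fibre `T^{(k)}Y_0 = −D_k`.  This file is the algebra of that situation: the structure split of
✓ p606268 WITH AN ARBITRARY SOURCE FAMILY `R` (the source joins the reduced part; the coarse gauge function keeps its recursion), for ANY comb maps `CM_j`,
plus the triangle inequality `‖D_k(c)‖ ≤ ‖G^D_k(c)‖ + ‖Λ^D_k(c₋)‖ + ‖Λ^D_k(c₊)‖` and the `Nat.rec` existence of the sourced reduced family at the covariant comb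
mean.  The `ℓ²` propagation (file A2) and the instantiation at the nonlinear remainders (file B) follow.

WHAT IS PROVED (ns `…Theorems.Prop7TrueLinSourcedStructure`; `T_j`, `P_V` WRITTEN OUT as in ✓ p606268; `D`, `R`, `G`, `Λ`, `CM` displayed by recursion hypotheses).
* ★★ `sourced_structure` — `∀ k, (guards below k) → ∀ c, D k c = G k c + P_{Ū₀^{(k)}}(Λ k)(c)`.
* ★ `norm_le_of_sourced_structure` — `‖D k c‖ ≤ ‖G k c‖ + ‖Λ k c₋‖ + ‖Λ k c₊‖`.
* `exists_sourced_reduced_family` — the sourced reduced family at the covariant comb mean exists (`Nat.rec`); `Λ` exists by ✓ `Prop7CurvedLandauRowA.exists_coarseGauge_family`.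
HONEST SCOPE.  Identities (linearity ✓ p605789 `trueLin_add` and pure-gauge exactness ✓ p603693 `trueLin_pureGauge`) and the triangle inequality; no analysis.

References: T. Bałaban, CMP 95 (1984) 17–40 [Balaban1984PropagatorsI] ((1.18)–(1.20) pp.19–20); CMP 98 (1985) 17–51 [Balaban1985Averaging] ((11) p.19, Prop. 3 (124) p.36);
CMP 102 (1985) 277–309 [Balaban1985Variational] (Prop. 7 p.299).
-/

set_option autoImplicit false

noncomputable section

open scoped BigOperators Matrix.Norms.L2Operator

namespace Summit.QuantumFields.YangMills.Theorems.Prop7TrueLinSourcedStructure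

open Literature.MathematicalPhysics.QuantumFieldTheory.Balaban1983to89
open Finset T4Continuum BlockAveraging AveragingRT ExpMeanLog BlockAveragingEMLLinearised BlockAveragingEMLLinearisedBackground BlockAveragingEMLProp2
open Summit.QuantumFields.YangMills.Theorems.Prop7TrueLinPureGauge (trueLin_pureGauge)
open Summit.QuantumFields.YangMills.Theorems.Prop7TrueLinPureGaugeIter (trueLin_add)
open Summit.QuantumFields.YangMills.Theorems.Prop7TrueLinIterStructure (norm_pureGauge_le)

variable {P : Params} {n : Type*} [Fintype n] [DecidableEq n] [Nonempty n]

/-! ## §1 ★★ The sourced structure recursion -/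

/-- ★★ **THE STRUCTURE RECURSION WITH SOURCES.**  Background tower `Ū₀^{(j)} = Averaging.iter (blockAvg ℰp) j U₀`; `D` ANY family driven by the true one-step
linearisations WITH SOURCES `R` (`hDs : D (j+1) c = T_j(D j)(c) + R j c`); `CM j` ANY maps from `j`-bond fields to `(j+1)`-site functions; `G`, `Λ` the recursion
families `G 0 = D 0`, `G (j+1) c = T_j(G j)(c) − P_{Ū₀^{(j+1)}}(CM j (G j))(c) + R j c`, `Λ 0 = 0`, `Λ (j+1) z = CM j (G j) z + Λ j (emb z)`.  Then under the per-level
(0.4) guards `dist1(W^{(j)}_i(c)) < δ_N` (`j < k`):  `D k c = G k c + (Λ k c₋ − Ū₀^{(k)}(c)·Λ k c₊·Ū₀^{(k)}(c)*)` for every `k`-bond `c`.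
[cite: Balaban1984PropagatorsI, (1.18)-(1.20) pp.19-20; Balaban1985Averaging, (11) p.19] -/
theorem sourced_structure (U₀ : GaugeField P 0 (Matrix.specialUnitaryGroup n ℂ))
    (D : (k : ℕ) → PBond P k → Matrix n n ℂ) (R : (k : ℕ) → PBond P (k + 1) → Matrix n n ℂ)
    (hDs : ∀ (k : ℕ) (c : PBond P (k + 1)), D (k + 1) c = (fderiv ℂ (eml : (Idx P → Matrix n n ℂ) → Matrix n n ℂ)
            (fun i => ((loopHol (Averaging.iter (fun i => blockAvg (P := P) (j := i) (expMeanLogSU (n := n))) k U₀) c i : Matrix.specialUnitaryGroup n ℂ) : Matrix n n ℂ))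
            (fun i => covWalkSum (Averaging.iter (fun i => blockAvg (P := P) (j := i) (expMeanLogSU (n := n))) k U₀) (D k) (walk (emb c.src) (loopWord P.L c.dir (off i.1) i.2.1 i.2.2))
              * ((loopHol (Averaging.iter (fun i => blockAvg (P := P) (j := i) (expMeanLogSU (n := n))) k U₀) c i : Matrix.specialUnitaryGroup n ℂ) : Matrix n n ℂ))
            * star ((corr (expMeanLogSU (n := n)) (Averaging.iter (fun i => blockAvg (P := P) (j := i) (expMeanLogSU (n := n))) k U₀) c : Matrix.specialUnitaryGroup n ℂ) : Matrix n n ℂ)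
          + ((corr (expMeanLogSU (n := n)) (Averaging.iter (fun i => blockAvg (P := P) (j := i) (expMeanLogSU (n := n))) k U₀) c : Matrix.specialUnitaryGroup n ℂ) : Matrix n n ℂ)
            * covWalkSum (Averaging.iter (fun i => blockAvg (P := P) (j := i) (expMeanLogSU (n := n))) k U₀) (D k) (walk (emb c.src) (List.replicate P.L (c.dir, true)))
            * star ((corr (expMeanLogSU (n := n)) (Averaging.iter (fun i => blockAvg (P := P) (j := i) (expMeanLogSU (n := n))) k U₀) c : Matrix.specialUnitaryGroup n ℂ) : Matrix n n ℂ)) + R k c)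
    (CM : (k : ℕ) → (PBond P k → Matrix n n ℂ) → Site P (k + 1) → Matrix n n ℂ)
    (G : (k : ℕ) → PBond P k → Matrix n n ℂ) (Λ : (k : ℕ) → Site P k → Matrix n n ℂ)
    (hG0 : ∀ b, G 0 b = D 0 b) (hΛ0 : ∀ x, Λ 0 x = 0)
    (hΛs : ∀ (k : ℕ) (z : Site P (k + 1)), Λ (k + 1) z = CM k (G k) z + Λ k (emb z))
    (hGs : ∀ (k : ℕ) (c : PBond P (k + 1)), G (k + 1) c
      = (fderiv ℂ (eml : (Idx P → Matrix n n ℂ) → Matrix n n ℂ)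
            (fun i => ((loopHol (Averaging.iter (fun i => blockAvg (P := P) (j := i) (expMeanLogSU (n := n))) k U₀) c i : Matrix.specialUnitaryGroup n ℂ) : Matrix n n ℂ))
            (fun i => covWalkSum (Averaging.iter (fun i => blockAvg (P := P) (j := i) (expMeanLogSU (n := n))) k U₀) (G k) (walk (emb c.src) (loopWord P.L c.dir (off i.1) i.2.1 i.2.2))
              * ((loopHol (Averaging.iter (fun i => blockAvg (P := P) (j := i) (expMeanLogSU (n := n))) k U₀) c i : Matrix.specialUnitaryGroup n ℂ) : Matrix n n ℂ))
            * star ((corr (expMeanLogSU (n := n)) (Averaging.iter (fun i => blockAvg (P := P) (j := i) (expMeanLogSU (n := n))) k U₀) c : Matrix.specialUnitaryGroup n ℂ) : Matrix n n ℂ)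
          + ((corr (expMeanLogSU (n := n)) (Averaging.iter (fun i => blockAvg (P := P) (j := i) (expMeanLogSU (n := n))) k U₀) c : Matrix.specialUnitaryGroup n ℂ) : Matrix n n ℂ)
            * covWalkSum (Averaging.iter (fun i => blockAvg (P := P) (j := i) (expMeanLogSU (n := n))) k U₀) (G k) (walk (emb c.src) (List.replicate P.L (c.dir, true)))
            * star ((corr (expMeanLogSU (n := n)) (Averaging.iter (fun i => blockAvg (P := P) (j := i) (expMeanLogSU (n := n))) k U₀) c : Matrix.specialUnitaryGroup n ℂ) : Matrix n n ℂ))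
        - (CM k (G k) c.src - ((Averaging.iter (fun i => blockAvg (P := P) (j := i) (expMeanLogSU (n := n))) (k + 1) U₀ c : Matrix.specialUnitaryGroup n ℂ) : Matrix n n ℂ) * CM k (G k) c.tgt * star ((Averaging.iter (fun i => blockAvg (P := P) (j := i) (expMeanLogSU (n := n))) (k + 1) U₀ c : Matrix.specialUnitaryGroup n ℂ) : Matrix n n ℂ))
        + R k c) :
    ∀ k : ℕ, (∀ j < k, ∀ (c : PBond P (j + 1)) (i : Idx P),
        dist1 (loopHol (Averaging.iter (fun i => blockAvg (P := P) (j := i) (expMeanLogSU (n := n))) j U₀) c i) < deltaSU n) →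
      ∀ c : PBond P k, D k c
        = G k c + (Λ k c.src - ((Averaging.iter (fun i => blockAvg (P := P) (j := i) (expMeanLogSU (n := n))) k U₀ c : Matrix.specialUnitaryGroup n ℂ) : Matrix n n ℂ) * Λ k c.tgt * star ((Averaging.iter (fun i => blockAvg (P := P) (j := i) (expMeanLogSU (n := n))) k U₀ c : Matrix.specialUnitaryGroup n ℂ) : Matrix n n ℂ)) := by
  intro k
  induction k with
  | zero =>
    intro _ c
    rw [hG0, hΛ0, hΛ0, mul_zero, zero_mul, sub_zero, add_zero]
  | succ k ih =>
    intro hg c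
    have hfun : D k = G k + fun b : PBond P k => (Λ k b.src - ((Averaging.iter (fun i => blockAvg (P := P) (j := i) (expMeanLogSU (n := n))) k U₀ b : Matrix.specialUnitaryGroup n ℂ) : Matrix n n ℂ) * Λ k b.tgt * star ((Averaging.iter (fun i => blockAvg (P := P) (j := i) (expMeanLogSU (n := n))) k U₀ b : Matrix.specialUnitaryGroup n ℂ) : Matrix n n ℂ)) :=
      funext fun b => by rw [Pi.add_apply]; exact ih (fun j hj => hg j (Nat.lt_succ_of_lt hj)) b
    have hit : Averaging.iter (fun i => blockAvg (P := P) (j := i) (expMeanLogSU (n := n))) (k + 1) U₀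
        = avgFun (expMeanLogSU (n := n)) (Averaging.iter (fun i => blockAvg (P := P) (j := i) (expMeanLogSU (n := n))) k U₀) := rfl
    rw [hDs, hfun, trueLin_add, trueLin_pureGauge (Averaging.iter (fun i => blockAvg (P := P) (j := i) (expMeanLogSU (n := n))) k U₀) (Λ k) c
      (hg k (Nat.lt_succ_self k) c), hGs, hΛs, hΛs, hit]
    noncomm_ring

/-- ★ **THE SOURCED FAMILY IS CONTROLLED BY ITS REDUCED PART AND THE COARSE GAUGE FUNCTION**: under the hypotheses of `sourced_structure`, for every `k`-bond `c`,
`‖D k c‖ ≤ ‖G k c‖ + ‖Λ k c₋‖ + ‖Λ k c₊‖`. [cite: Balaban1985Variational, Prop. 7 p.299] -/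
theorem norm_le_of_sourced_structure (U₀ : GaugeField P 0 (Matrix.specialUnitaryGroup n ℂ))
    (D : (k : ℕ) → PBond P k → Matrix n n ℂ) (R : (k : ℕ) → PBond P (k + 1) → Matrix n n ℂ)
    (hDs : ∀ (k : ℕ) (c : PBond P (k + 1)), D (k + 1) c = (fderiv ℂ (eml : (Idx P → Matrix n n ℂ) → Matrix n n ℂ)
            (fun i => ((loopHol (Averaging.iter (fun i => blockAvg (P := P) (j := i) (expMeanLogSU (n := n))) k U₀) c i : Matrix.specialUnitaryGroup n ℂ) : Matrix n n ℂ))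
            (fun i => covWalkSum (Averaging.iter (fun i => blockAvg (P := P) (j := i) (expMeanLogSU (n := n))) k U₀) (D k) (walk (emb c.src) (loopWord P.L c.dir (off i.1) i.2.1 i.2.2))
              * ((loopHol (Averaging.iter (fun i => blockAvg (P := P) (j := i) (expMeanLogSU (n := n))) k U₀) c i : Matrix.specialUnitaryGroup n ℂ) : Matrix n n ℂ))
            * star ((corr (expMeanLogSU (n := n)) (Averaging.iter (fun i => blockAvg (P := P) (j := i) (expMeanLogSU (n := n))) k U₀) c : Matrix.specialUnitaryGroup n ℂ) : Matrix n n ℂ)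
          + ((corr (expMeanLogSU (n := n)) (Averaging.iter (fun i => blockAvg (P := P) (j := i) (expMeanLogSU (n := n))) k U₀) c : Matrix.specialUnitaryGroup n ℂ) : Matrix n n ℂ)
            * covWalkSum (Averaging.iter (fun i => blockAvg (P := P) (j := i) (expMeanLogSU (n := n))) k U₀) (D k) (walk (emb c.src) (List.replicate P.L (c.dir, true)))
            * star ((corr (expMeanLogSU (n := n)) (Averaging.iter (fun i => blockAvg (P := P) (j := i) (expMeanLogSU (n := n))) k U₀) c : Matrix.specialUnitaryGroup n ℂ) : Matrix n n ℂ)) + R k c)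
    (CM : (k : ℕ) → (PBond P k → Matrix n n ℂ) → Site P (k + 1) → Matrix n n ℂ)
    (G : (k : ℕ) → PBond P k → Matrix n n ℂ) (Λ : (k : ℕ) → Site P k → Matrix n n ℂ)
    (hG0 : ∀ b, G 0 b = D 0 b) (hΛ0 : ∀ x, Λ 0 x = 0)
    (hΛs : ∀ (k : ℕ) (z : Site P (k + 1)), Λ (k + 1) z = CM k (G k) z + Λ k (emb z))
    (hGs : ∀ (k : ℕ) (c : PBond P (k + 1)), G (k + 1) c
      = (fderiv ℂ (eml : (Idx P → Matrix n n ℂ) → Matrix n n ℂ)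
            (fun i => ((loopHol (Averaging.iter (fun i => blockAvg (P := P) (j := i) (expMeanLogSU (n := n))) k U₀) c i : Matrix.specialUnitaryGroup n ℂ) : Matrix n n ℂ))
            (fun i => covWalkSum (Averaging.iter (fun i => blockAvg (P := P) (j := i) (expMeanLogSU (n := n))) k U₀) (G k) (walk (emb c.src) (loopWord P.L c.dir (off i.1) i.2.1 i.2.2))
              * ((loopHol (Averaging.iter (fun i => blockAvg (P := P) (j := i) (expMeanLogSU (n := n))) k U₀) c i : Matrix.specialUnitaryGroup n ℂ) : Matrix n n ℂ))
            * star ((corr (expMeanLogSU (n := n)) (Averaging.iter (fun i => blockAvg (P := P) (j := i) (expMeanLogSU (n := n))) k U₀) c : Matrix.specialUnitaryGroup n ℂ) : Matrix n n ℂ)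
          + ((corr (expMeanLogSU (n := n)) (Averaging.iter (fun i => blockAvg (P := P) (j := i) (expMeanLogSU (n := n))) k U₀) c : Matrix.specialUnitaryGroup n ℂ) : Matrix n n ℂ)
            * covWalkSum (Averaging.iter (fun i => blockAvg (P := P) (j := i) (expMeanLogSU (n := n))) k U₀) (G k) (walk (emb c.src) (List.replicate P.L (c.dir, true)))
            * star ((corr (expMeanLogSU (n := n)) (Averaging.iter (fun i => blockAvg (P := P) (j := i) (expMeanLogSU (n := n))) k U₀) c : Matrix.specialUnitaryGroup n ℂ) : Matrix n n ℂ))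
        - (CM k (G k) c.src - ((Averaging.iter (fun i => blockAvg (P := P) (j := i) (expMeanLogSU (n := n))) (k + 1) U₀ c : Matrix.specialUnitaryGroup n ℂ) : Matrix n n ℂ) * CM k (G k) c.tgt * star ((Averaging.iter (fun i => blockAvg (P := P) (j := i) (expMeanLogSU (n := n))) (k + 1) U₀ c : Matrix.specialUnitaryGroup n ℂ) : Matrix n n ℂ))
        + R k c)
    {k : ℕ} (hg : ∀ j < k, ∀ (c : PBond P (j + 1)) (i : Idx P),
        dist1 (loopHol (Averaging.iter (fun i => blockAvg (P := P) (j := i) (expMeanLogSU (n := n))) j U₀) c i) < deltaSU n)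
    (c : PBond P k) :
    ‖D k c‖ ≤ ‖G k c‖ + ‖Λ k c.src‖ + ‖Λ k c.tgt‖ := by
  rw [sourced_structure U₀ D R hDs CM G Λ hG0 hΛ0 hΛs hGs k hg c]
  exact (norm_add_le _ _).trans (add_le_add le_rfl (norm_pureGauge_le _ (Λ k) c)) |>.trans (le_of_eq (by ring))

/-! ## §2 The sourced reduced family at the covariant comb mean exists -/

/-- The sourced reduced family at the covariant comb mean — `G 0 = D₀`, `G (k+1) c = T(Ū₀^{(k)})(G k)(c) − P_{Ū₀^{(k+1)}}(CM_k(G k))(c) + R k c` — exists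
for every initial field `D₀` and every source family `R` (`Nat.rec`). [cite: Balaban1984PropagatorsI, (1.18)-(1.20) pp.19-20] -/
theorem exists_sourced_reduced_family (U₀ : GaugeField P 0 (Matrix.specialUnitaryGroup n ℂ)) (D₀ : PBond P 0 → Matrix n n ℂ)
    (R : (k : ℕ) → PBond P (k + 1) → Matrix n n ℂ) :
    ∃ G : (k : ℕ) → PBond P k → Matrix n n ℂ, (∀ b, G 0 b = D₀ b) ∧
      ∀ (k : ℕ) (c : PBond P (k + 1)), G (k + 1) c
        = (fderiv ℂ (eml : (Idx P → Matrix n n ℂ) → Matrix n n ℂ)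
            (fun i => ((loopHol (Averaging.iter (fun i => blockAvg (P := P) (j := i) (expMeanLogSU (n := n))) k U₀) c i : Matrix.specialUnitaryGroup n ℂ) : Matrix n n ℂ))
            (fun i => covWalkSum (Averaging.iter (fun i => blockAvg (P := P) (j := i) (expMeanLogSU (n := n))) k U₀) (G k) (walk (emb c.src) (loopWord P.L c.dir (off i.1) i.2.1 i.2.2))
              * ((loopHol (Averaging.iter (fun i => blockAvg (P := P) (j := i) (expMeanLogSU (n := n))) k U₀) c i : Matrix.specialUnitaryGroup n ℂ) : Matrix n n ℂ))
            * star ((corr (expMeanLogSU (n := n)) (Averaging.iter (fun i => blockAvg (P := P) (j := i) (expMeanLogSU (n := n))) k U₀) c : Matrix.specialUnitaryGroup n ℂ) : Matrix n n ℂ)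
          + ((corr (expMeanLogSU (n := n)) (Averaging.iter (fun i => blockAvg (P := P) (j := i) (expMeanLogSU (n := n))) k U₀) c : Matrix.specialUnitaryGroup n ℂ) : Matrix n n ℂ)
            * covWalkSum (Averaging.iter (fun i => blockAvg (P := P) (j := i) (expMeanLogSU (n := n))) k U₀) (G k) (walk (emb c.src) (List.replicate P.L (c.dir, true)))
            * star ((corr (expMeanLogSU (n := n)) (Averaging.iter (fun i => blockAvg (P := P) (j := i) (expMeanLogSU (n := n))) k U₀) c : Matrix.specialUnitaryGroup n ℂ) : Matrix n n ℂ))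
          - ((((Fintype.card (Idx P) : ℂ))⁻¹ • ∑ i : Idx P,
                covWalkSum (Averaging.iter (fun i => blockAvg (P := P) (j := i) (expMeanLogSU (n := n))) k U₀) (G k)
                  (walk (emb c.src) (stairWord i.2.1 (off i.1))))
              - ((Averaging.iter (fun i => blockAvg (P := P) (j := i) (expMeanLogSU (n := n))) (k + 1) U₀ c : Matrix.specialUnitaryGroup n ℂ) :
                  Matrix n n ℂ)
                * (((Fintype.card (Idx P) : ℂ))⁻¹ • ∑ i : Idx P,
                    covWalkSum (Averaging.iter (fun i => blockAvg (P := P) (j := i) (expMeanLogSU (n := n))) k U₀) (G k)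
                      (walk (emb c.tgt) (stairWord i.2.1 (off i.1))))
                * star ((Averaging.iter (fun i => blockAvg (P := P) (j := i) (expMeanLogSU (n := n))) (k + 1) U₀ c :
                  Matrix.specialUnitaryGroup n ℂ) : Matrix n n ℂ))
          + R k c := by
  refine ⟨fun k => Nat.rec (motive := fun k => PBond P k → Matrix n n ℂ) D₀
    (fun k Gk => fun c =>
      (fderiv ℂ (eml : (Idx P → Matrix n n ℂ) → Matrix n n ℂ)
            (fun i => ((loopHol (Averaging.iter (fun i => blockAvg (P := P) (j := i) (expMeanLogSU (n := n))) k U₀) c i : Matrix.specialUnitaryGroup n ℂ) : Matrix n n ℂ))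
            (fun i => covWalkSum (Averaging.iter (fun i => blockAvg (P := P) (j := i) (expMeanLogSU (n := n))) k U₀) Gk (walk (emb c.src) (loopWord P.L c.dir (off i.1) i.2.1 i.2.2))
              * ((loopHol (Averaging.iter (fun i => blockAvg (P := P) (j := i) (expMeanLogSU (n := n))) k U₀) c i : Matrix.specialUnitaryGroup n ℂ) : Matrix n n ℂ))
            * star ((corr (expMeanLogSU (n := n)) (Averaging.iter (fun i => blockAvg (P := P) (j := i) (expMeanLogSU (n := n))) k U₀) c : Matrix.specialUnitaryGroup n ℂ) : Matrix n n ℂ)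
          + ((corr (expMeanLogSU (n := n)) (Averaging.iter (fun i => blockAvg (P := P) (j := i) (expMeanLogSU (n := n))) k U₀) c : Matrix.specialUnitaryGroup n ℂ) : Matrix n n ℂ)
            * covWalkSum (Averaging.iter (fun i => blockAvg (P := P) (j := i) (expMeanLogSU (n := n))) k U₀) Gk (walk (emb c.src) (List.replicate P.L (c.dir, true)))
            * star ((corr (expMeanLogSU (n := n)) (Averaging.iter (fun i => blockAvg (P := P) (j := i) (expMeanLogSU (n := n))) k U₀) c : Matrix.specialUnitaryGroup n ℂ) : Matrix n n ℂ))
        - ((((Fintype.card (Idx P) : ℂ))⁻¹ • ∑ i : Idx P,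
              covWalkSum (Averaging.iter (fun i => blockAvg (P := P) (j := i) (expMeanLogSU (n := n))) k U₀) Gk
                (walk (emb c.src) (stairWord i.2.1 (off i.1))))
            - ((Averaging.iter (fun i => blockAvg (P := P) (j := i) (expMeanLogSU (n := n))) (k + 1) U₀ c : Matrix.specialUnitaryGroup n ℂ) :
                Matrix n n ℂ)
              * (((Fintype.card (Idx P) : ℂ))⁻¹ • ∑ i : Idx P,
                  covWalkSum (Averaging.iter (fun i => blockAvg (P := P) (j := i) (expMeanLogSU (n := n))) k U₀) Gk
                    (walk (emb c.tgt) (stairWord i.2.1 (off i.1))))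
              * star ((Averaging.iter (fun i => blockAvg (P := P) (j := i) (expMeanLogSU (n := n))) (k + 1) U₀ c :
                Matrix.specialUnitaryGroup n ℂ) : Matrix n n ℂ))
        + R k c) k, fun _ => rfl, fun _ _ => rfl⟩

/-- The sourced family itself — `D 0 = D₀`, `D (k+1) c = T(Ū₀^{(k)})(D k)(c) + R k c` — exists and is determined by `D₀` and `R` (`Nat.rec`); used to
identify ANY family obeying the sourced recursion (e.g. the nonlinear level ratios) with THE solution. [cite: Balaban1984PropagatorsI, (1.18)-(1.20) pp.19-20] -/
theorem exists_sourced_family (U₀ : GaugeField P 0 (Matrix.specialUnitaryGroup n ℂ)) (D₀ : PBond P 0 → Matrix n n ℂ)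
    (R : (k : ℕ) → PBond P (k + 1) → Matrix n n ℂ) :
    ∃ D : (k : ℕ) → PBond P k → Matrix n n ℂ, (∀ b, D 0 b = D₀ b) ∧
      ∀ (k : ℕ) (c : PBond P (k + 1)), D (k + 1) c = (fderiv ℂ (eml : (Idx P → Matrix n n ℂ) → Matrix n n ℂ)
            (fun i => ((loopHol (Averaging.iter (fun i => blockAvg (P := P) (j := i) (expMeanLogSU (n := n))) k U₀) c i : Matrix.specialUnitaryGroup n ℂ) : Matrix n n ℂ))
            (fun i => covWalkSum (Averaging.iter (fun i => blockAvg (P := P) (j := i) (expMeanLogSU (n := n))) k U₀) (D k) (walk (emb c.src) (loopWord P.L c.dir (off i.1) i.2.1 i.2.2))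
              * ((loopHol (Averaging.iter (fun i => blockAvg (P := P) (j := i) (expMeanLogSU (n := n))) k U₀) c i : Matrix.specialUnitaryGroup n ℂ) : Matrix n n ℂ))
            * star ((corr (expMeanLogSU (n := n)) (Averaging.iter (fun i => blockAvg (P := P) (j := i) (expMeanLogSU (n := n))) k U₀) c : Matrix.specialUnitaryGroup n ℂ) : Matrix n n ℂ)
          + ((corr (expMeanLogSU (n := n)) (Averaging.iter (fun i => blockAvg (P := P) (j := i) (expMeanLogSU (n := n))) k U₀) c : Matrix.specialUnitaryGroup n ℂ) : Matrix n n ℂ)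
            * covWalkSum (Averaging.iter (fun i => blockAvg (P := P) (j := i) (expMeanLogSU (n := n))) k U₀) (D k) (walk (emb c.src) (List.replicate P.L (c.dir, true)))
            * star ((corr (expMeanLogSU (n := n)) (Averaging.iter (fun i => blockAvg (P := P) (j := i) (expMeanLogSU (n := n))) k U₀) c : Matrix.specialUnitaryGroup n ℂ) : Matrix n n ℂ)) + R k c := by
  refine ⟨fun k => Nat.rec (motive := fun k => PBond P k → Matrix n n ℂ) D₀
    (fun k Dk => fun c => (fderiv ℂ (eml : (Idx P → Matrix n n ℂ) → Matrix n n ℂ)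
            (fun i => ((loopHol (Averaging.iter (fun i => blockAvg (P := P) (j := i) (expMeanLogSU (n := n))) k U₀) c i : Matrix.specialUnitaryGroup n ℂ) : Matrix n n ℂ))
            (fun i => covWalkSum (Averaging.iter (fun i => blockAvg (P := P) (j := i) (expMeanLogSU (n := n))) k U₀) Dk (walk (emb c.src) (loopWord P.L c.dir (off i.1) i.2.1 i.2.2))
              * ((loopHol (Averaging.iter (fun i => blockAvg (P := P) (j := i) (expMeanLogSU (n := n))) k U₀) c i : Matrix.specialUnitaryGroup n ℂ) : Matrix n n ℂ))
            * star ((corr (expMeanLogSU (n := n)) (Averaging.iter (fun i => blockAvg (P := P) (j := i) (expMeanLogSU (n := n))) k U₀) c : Matrix.specialUnitaryGroup n ℂ) : Matrix n n ℂ)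
          + ((corr (expMeanLogSU (n := n)) (Averaging.iter (fun i => blockAvg (P := P) (j := i) (expMeanLogSU (n := n))) k U₀) c : Matrix.specialUnitaryGroup n ℂ) : Matrix n n ℂ)
            * covWalkSum (Averaging.iter (fun i => blockAvg (P := P) (j := i) (expMeanLogSU (n := n))) k U₀) Dk (walk (emb c.src) (List.replicate P.L (c.dir, true)))
            * star ((corr (expMeanLogSU (n := n)) (Averaging.iter (fun i => blockAvg (P := P) (j := i) (expMeanLogSU (n := n))) k U₀) c : Matrix.specialUnitaryGroup n ℂ) : Matrix n n ℂ)) + R k c) k, fun _ => rfl, fun _ _ => rfl⟩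

/-! ## §3 The difference of two driven families is sourced by the difference of the drives -/

/-- **LINEARITY OF THE DRIVE**: if `Y (j+1) c = T_j(Y j)(c) + R j c` (e.g. the nonlinear level ratios with their one-step remainders) and `Q (j+1) c = T_j(Q j)(c)`
(the exact linear iterate), then `D j := Y j − Q j` obeys `D (j+1) c = T_j(D j)(c) + R j c` — so `sourced_structure` applies to `D` with `D 0 = Y 0 − Q 0`.
[cite: Balaban1984PropagatorsI, (1.18)-(1.20) pp.19-20] -/
theorem sub_sourced (U₀ : GaugeField P 0 (Matrix.specialUnitaryGroup n ℂ))
    (Y Q : (k : ℕ) → PBond P k → Matrix n n ℂ) (R : (k : ℕ) → PBond P (k + 1) → Matrix n n ℂ)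
    (hYs : ∀ (k : ℕ) (c : PBond P (k + 1)), Y (k + 1) c = (fderiv ℂ (eml : (Idx P → Matrix n n ℂ) → Matrix n n ℂ)
            (fun i => ((loopHol (Averaging.iter (fun i => blockAvg (P := P) (j := i) (expMeanLogSU (n := n))) k U₀) c i : Matrix.specialUnitaryGroup n ℂ) : Matrix n n ℂ))
            (fun i => covWalkSum (Averaging.iter (fun i => blockAvg (P := P) (j := i) (expMeanLogSU (n := n))) k U₀) (Y k) (walk (emb c.src) (loopWord P.L c.dir (off i.1) i.2.1 i.2.2))
              * ((loopHol (Averaging.iter (fun i => blockAvg (P := P) (j := i) (expMeanLogSU (n := n))) k U₀) c i : Matrix.specialUnitaryGroup n ℂ) : Matrix n n ℂ))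
            * star ((corr (expMeanLogSU (n := n)) (Averaging.iter (fun i => blockAvg (P := P) (j := i) (expMeanLogSU (n := n))) k U₀) c : Matrix.specialUnitaryGroup n ℂ) : Matrix n n ℂ)
          + ((corr (expMeanLogSU (n := n)) (Averaging.iter (fun i => blockAvg (P := P) (j := i) (expMeanLogSU (n := n))) k U₀) c : Matrix.specialUnitaryGroup n ℂ) : Matrix n n ℂ)
            * covWalkSum (Averaging.iter (fun i => blockAvg (P := P) (j := i) (expMeanLogSU (n := n))) k U₀) (Y k) (walk (emb c.src) (List.replicate P.L (c.dir, true)))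
            * star ((corr (expMeanLogSU (n := n)) (Averaging.iter (fun i => blockAvg (P := P) (j := i) (expMeanLogSU (n := n))) k U₀) c : Matrix.specialUnitaryGroup n ℂ) : Matrix n n ℂ)) + R k c)
    (hQs : ∀ (k : ℕ) (c : PBond P (k + 1)), Q (k + 1) c = (fderiv ℂ (eml : (Idx P → Matrix n n ℂ) → Matrix n n ℂ)
            (fun i => ((loopHol (Averaging.iter (fun i => blockAvg (P := P) (j := i) (expMeanLogSU (n := n))) k U₀) c i : Matrix.specialUnitaryGroup n ℂ) : Matrix n n ℂ))
            (fun i => covWalkSum (Averaging.iter (fun i => blockAvg (P := P) (j := i) (expMeanLogSU (n := n))) k U₀) (Q k) (walk (emb c.src) (loopWord P.L c.dir (off i.1) i.2.1 i.2.2))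
              * ((loopHol (Averaging.iter (fun i => blockAvg (P := P) (j := i) (expMeanLogSU (n := n))) k U₀) c i : Matrix.specialUnitaryGroup n ℂ) : Matrix n n ℂ))
            * star ((corr (expMeanLogSU (n := n)) (Averaging.iter (fun i => blockAvg (P := P) (j := i) (expMeanLogSU (n := n))) k U₀) c : Matrix.specialUnitaryGroup n ℂ) : Matrix n n ℂ)
          + ((corr (expMeanLogSU (n := n)) (Averaging.iter (fun i => blockAvg (P := P) (j := i) (expMeanLogSU (n := n))) k U₀) c : Matrix.specialUnitaryGroup n ℂ) : Matrix n n ℂ)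
            * covWalkSum (Averaging.iter (fun i => blockAvg (P := P) (j := i) (expMeanLogSU (n := n))) k U₀) (Q k) (walk (emb c.src) (List.replicate P.L (c.dir, true)))
            * star ((corr (expMeanLogSU (n := n)) (Averaging.iter (fun i => blockAvg (P := P) (j := i) (expMeanLogSU (n := n))) k U₀) c : Matrix.specialUnitaryGroup n ℂ) : Matrix n n ℂ)))
    (k : ℕ) (c : PBond P (k + 1)) :
    (Y (k + 1) - Q (k + 1)) c = (fderiv ℂ (eml : (Idx P → Matrix n n ℂ) → Matrix n n ℂ)
            (fun i => ((loopHol (Averaging.iter (fun i => blockAvg (P := P) (j := i) (expMeanLogSU (n := n))) k U₀) c i : Matrix.specialUnitaryGroup n ℂ) : Matrix n n ℂ))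
            (fun i => covWalkSum (Averaging.iter (fun i => blockAvg (P := P) (j := i) (expMeanLogSU (n := n))) k U₀) (Y k - Q k) (walk (emb c.src) (loopWord P.L c.dir (off i.1) i.2.1 i.2.2))
              * ((loopHol (Averaging.iter (fun i => blockAvg (P := P) (j := i) (expMeanLogSU (n := n))) k U₀) c i : Matrix.specialUnitaryGroup n ℂ) : Matrix n n ℂ))
            * star ((corr (expMeanLogSU (n := n)) (Averaging.iter (fun i => blockAvg (P := P) (j := i) (expMeanLogSU (n := n))) k U₀) c : Matrix.specialUnitaryGroup n ℂ) : Matrix n n ℂ)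
          + ((corr (expMeanLogSU (n := n)) (Averaging.iter (fun i => blockAvg (P := P) (j := i) (expMeanLogSU (n := n))) k U₀) c : Matrix.specialUnitaryGroup n ℂ) : Matrix n n ℂ)
            * covWalkSum (Averaging.iter (fun i => blockAvg (P := P) (j := i) (expMeanLogSU (n := n))) k U₀) (Y k - Q k) (walk (emb c.src) (List.replicate P.L (c.dir, true)))
            * star ((corr (expMeanLogSU (n := n)) (Averaging.iter (fun i => blockAvg (P := P) (j := i) (expMeanLogSU (n := n))) k U₀) c : Matrix.specialUnitaryGroup n ℂ) : Matrix n n ℂ)) + R k c := by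
  rw [Pi.sub_apply, hYs, hQs, Prop7TrueLinPureGaugeIter.trueLin_sub]
  abel

end Summit.QuantumFields.YangMills.Theorems.Prop7TrueLinSourcedStructure

end
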